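import Mathlib
import Literature.NumberTheory.LFunctions.Zhang2022.Section10cTop1214Int
import HarnessLib

/-!
# Zhang (2022) §10c: the "second line" of the middle range of `S_j(𝐚₁₂,𝐚₁₄)` (DAG node Z22:§10.u056 (ii))

Topic `Literature/NumberTheory/LFunctions/Zhang2022` (Landau–Siegel audit tree; verdict-neutral).
Y. Zhang, *Discrete mean estimates and the Landau–Siegel zero*, arXiv:2211.02515v1 (2022)
[Zhang2022LandauSiegel], §10 p. 61 (display at tex L3089, first → second line) — **an unrefereed
manuscript under adjudication; nothing here bears on its Theorems 1–2 or on Landau–Siegel zeros.**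
D-0069 campaign, discharge layer L3 (seat sz-d39; L3 LEDGER #15 (2)). Theorem-only, 0 defs/facts.

* `y1Profile_bounds`, `fProfile1214_bounds`, `midProfile_bounds` — the profile
  `t ↦ (ῑ₃𝔣_{j6}(P^{0.498}/t)/0.498 + ῑ₄𝔣_{j7}(P^{0.5}/t)/0.5)(−1 + 𝔶_{1j}(P^{0.004}t))` is `C¹` on
  `[1, P]` with `‖·‖ ≤ 87153`, `‖d/dt‖ ≤ 324109α/t`;
* `mid1214Int_holds : Mid1214Int c′` — **Z22:§10.u056 (ii) HOLDS as typed**, via the unconditional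
  engine `Typed.Sec10C.lamAvg_second_line` (sz-d34's `lamAvg_rule`), the main values
  `𝔣_{jμ}(P^w) = 𝔣𝔣_{jμ}(w) + O(𝓛⁻⁸)` (sz-d34's `norm_frakf_sub_ffJ`), `𝔶_{1j}(P^{z+0.004}) =
  𝔶𝔶_{1j}(z + 0.004) + O(𝓛⁻⁸)` (`Typed.Sec10A.step10u024_holds`, Z22:§10.u024), and `u = 0.498 − z`.

## References

* Y. Zhang, arXiv:2211.02515v1 (2022), §10 p. 61; §8 p. 48–49; §2 (2.13), (2.22), (2.26), (2.31).
  [cite: Zhang2022LandauSiegel, §10 p. 61]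
-/

noncomputable section

open Complex Real ComplexConjugate MeasureTheory
open Literature.NumberTheory.LFunctions.Zhang2022.Skeleton

namespace Literature.NumberTheory.LFunctions.Zhang2022.Typed.Sec10C

section D39Mid1214Int

/-- `‖ῑ₃x/0.498 + ῑ₄w/0.5‖ ≤ 7.2B` when `‖x‖, ‖w‖ ≤ B` (`|ι₃| ≤ 1.25`, `|ι₄| ≤ 2.3`, (2.26)).
[cite: Zhang2022LandauSiegel, §2 (2.26)] -/
theorem norm_iotaComb_le (x w : ℂ) {B : ℝ} (hx : ‖x‖ ≤ B) (hw : ‖w‖ ≤ B) :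
    ‖conj iota3 * x / 0.498 + conj iota4 * w / 0.5‖ ≤ 7.2 * B := by
  obtain ⟨hi3, hi4⟩ := norm_iota34_le
  have e498 : ‖(0.498 : ℂ)‖ = 0.498 := by norm_num
  have e5 : ‖(0.5 : ℂ)‖ = 0.5 := by norm_num
  have hB : 0 ≤ B := (norm_nonneg _).trans hx
  have c3 : ‖conj iota3‖ / 0.498 ≤ 2.6 := by
    rw [RCLike.norm_conj, div_le_iff₀ (by norm_num)]; linarith
  have c4 : ‖conj iota4‖ / 0.5 ≤ 4.6 := by
    rw [RCLike.norm_conj, div_le_iff₀ (by norm_num)]; linarith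
  calc ‖conj iota3 * x / 0.498 + conj iota4 * w / 0.5‖
      ≤ ‖conj iota3 * x / 0.498‖ + ‖conj iota4 * w / 0.5‖ := norm_add_le _ _
    _ = ‖conj iota3‖ / 0.498 * ‖x‖ + ‖conj iota4‖ / 0.5 * ‖w‖ := by
        rw [norm_div, norm_div, norm_mul, norm_mul, e498, e5]; ring
    _ ≤ 2.6 * B + 4.6 * B := by gcongr
    _ = 7.2 * B := by ring

/-- `1 ≤ P^e ≤ P` for `0 ≤ e ≤ 1` (`P ≥ 1`). [cite: Zhang2022LandauSiegel, §2 (2.6)] -/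
theorem rpow_window {D : ℕ} (hP1 : 1 ≤ bigP D) {e : ℝ} (h0 : 0 ≤ e) (h1 : e ≤ 1) :
    1 ≤ bigP D ^ e ∧ bigP D ^ e ≤ bigP D :=
  ⟨Real.one_le_rpow hP1 h0, by
    calc bigP D ^ e ≤ bigP D ^ (1 : ℝ) := Real.rpow_le_rpow_of_exponent_le hP1 h1
      _ = bigP D := Real.rpow_one _⟩

/-- `P^{0.502}/(P^{0.004}t) = P^{0.498}/t`. [cite: Zhang2022LandauSiegel, §10 p. 61] -/
theorem rpow502_div (D : ℕ) (t : ℝ) :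
    bigP D ^ (0.502 : ℝ) / (bigP D ^ (0.004 : ℝ) * t) = bigP D ^ (0.498 : ℝ) / t := by
  have hP : 0 < bigP D := Real.exp_pos _
  rw [← div_div, ← Real.rpow_sub hP]
  norm_num

/-- `P^{0.004}t/P^{0.5} = (P^{0.496}/t)⁻¹`. [cite: Zhang2022LandauSiegel, §10 p. 61] -/
theorem rpow004_mul_div (D : ℕ) (t : ℝ) :
    bigP D ^ (0.004 : ℝ) * t / bigP D ^ (0.5 : ℝ) = (bigP D ^ (0.496 : ℝ) / t)⁻¹ := by
  have hP : 0 < bigP D := Real.exp_pos _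
  have h5 : bigP D ^ (0.5 : ℝ) = bigP D ^ (0.004 : ℝ) * bigP D ^ (0.496 : ℝ) := by
    rw [← Real.rpow_add hP]; norm_num
  rw [inv_div, h5, mul_div_mul_left _ _ (Real.rpow_pos_of_pos hP _).ne']

/-- **`t ↦ −1 + 𝔶_{1j}(P^{0.004}t)` on `[1, P]`** (`𝔶_{1j}` (10.9) `= −(β_{j+1}+β_{j+2})L₁ + ½β_{j+1}β_{j+2}
(L₂² − 2L₃²)`, `L₁ = log(P^{0.496}/t)`, `L₂ = log(P^{0.5}/t)`, `L₃ = log(P^{0.498}/t)`): differentiable,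
`‖·‖ ≤ 417`, `‖d/dt‖ ≤ 200α/t` (given `5|c′|α𝓛 ≤ 1`, `α log P ≤ 4`). [cite: Zhang2022LandauSiegel, §10 (10.9)] -/
theorem y1Profile_bounds (c' : ℝ) {D : ℕ} (j : ℕ) {t : ℝ} (hα : 0 < alpha D) (hℓ : 0 ≤ ell D)
    (hc : 5 * |c'| * alpha D * ell D ≤ 1) (ht1 : 1 ≤ t) (htP : t ≤ bigP D)
    (hΛ4 : alpha D * Real.log (bigP D) ≤ 4) :
    DifferentiableAt ℝ (fun u : ℝ => -1 + fraky1 c' D j (bigP D ^ (0.004 : ℝ) * u)) t ∧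
      ‖-1 + fraky1 c' D j (bigP D ^ (0.004 : ℝ) * t)‖ ≤ 417 ∧
      ‖deriv (fun u : ℝ => -1 + fraky1 c' D j (bigP D ^ (0.004 : ℝ) * u)) t‖ ≤
        200 * alpha D / t := by
  have ht : 0 < t := by linarith
  have hP1 : 1 ≤ bigP D := by linarith
  obtain ⟨hQ1a, hQ1b⟩ := rpow_window hP1 (e := 0.496) (by norm_num) (by norm_num)
  obtain ⟨hQ2a, hQ2b⟩ := rpow_window hP1 (e := 0.5) (by norm_num) (by norm_num)
  obtain ⟨hQ3a, hQ3b⟩ := rpow_window hP1 (e := 0.498) (by norm_num) (by norm_num)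
  set Q₁ : ℝ := bigP D ^ (0.496 : ℝ) with hQ₁
  set Q₂ : ℝ := bigP D ^ (0.5 : ℝ) with hQ₂
  set Q₃ : ℝ := bigP D ^ (0.498 : ℝ) with hQ₃
  set S : ℂ := betaJ c' D (j + 1) + betaJ c' D (j + 2) with hS
  set Pr : ℂ := betaJ c' D (j + 1) * betaJ c' D (j + 2) with hPr
  set L : ℝ → ℝ → ℂ := fun Q u => ((Real.log (Q / u) : ℝ) : ℂ) with hL
  have hfun : (fun u : ℝ => -1 + fraky1 c' D j (bigP D ^ (0.004 : ℝ) * u)) =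
      fun u => -1 + S * -L Q₁ u + Pr / 2 * (L Q₂ u * L Q₂ u - 2 * (L Q₃ u * L Q₃ u)) := by
    funext u
    simp only [hL, fraky1, rpow504_div, rpow502_div, rpow004_mul_div, Real.log_inv, hS, hPr,
      hQ₁, hQ₂, hQ₃]
    push_cast
    ring
  have hLd : ∀ Q : ℝ, 0 < Q → HasDerivAt (fun u => L Q u) (-((t : ℂ)⁻¹)) t := fun Q hQ0 =>
    Section8AbelProfiles.hasDerivAt_ofReal_log_div hQ0 ht
  have hd1 := hLd Q₁ (by linarith); have hd2 := hLd Q₂ (by linarith); have hd3 := hLd Q₃ (by linarith)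
  have hd : HasDerivAt (fun u => -1 + S * -L Q₁ u + Pr / 2 * (L Q₂ u * L Q₂ u - 2 * (L Q₃ u * L Q₃ u)))
      ((S - Pr * L Q₂ t + 2 * Pr * L Q₃ t) * (t : ℂ)⁻¹) t := by
    have h := ((hd1.neg.const_mul S).const_add (-1)).add
      (((hd2.mul hd2).sub ((hd3.mul hd3).const_mul 2)).const_mul (Pr / 2))
    refine (h.congr_of_eventuallyEq (Filter.Eventually.of_forall fun x => ?_)).congr_deriv (by ring)
    simp only [Pi.add_apply, Pi.neg_apply, Pi.mul_apply, Pi.sub_apply]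
  -- sizes
  have hLb : ∀ Q : ℝ, 1 ≤ Q → Q ≤ bigP D → alpha D * ‖L Q t‖ ≤ 4 := by
    intro Q h1 h2
    have : ‖L Q t‖ = |Real.log (Q / t)| := by rw [hL]; simp only [Complex.norm_real, Real.norm_eq_abs]
    rw [this]
    exact (mul_le_mul_of_nonneg_left (Section8AbelProfiles.abs_log_div_le h1 h2 ht1 htP) hα.le).trans
      hΛ4
  have hb1 := hLb Q₁ hQ1a hQ1b
  have hb2 := hLb Q₂ hQ2a hQ2b
  have hb3 := hLb Q₃ hQ3a hQ3b
  have hβ1 := Section8AbelProfiles.norm_betaJ_le c' hα.le hℓ hc (j + 1)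
  have hβ2 := Section8AbelProfiles.norm_betaJ_le c' hα.le hℓ hc (j + 2)
  have hSn : ‖S‖ ≤ 8 * alpha D := (norm_add_le _ _).trans (by linarith)
  have hPrn : ‖Pr‖ ≤ (4 * alpha D) * (4 * alpha D) := by
    rw [hPr, norm_mul]; exact mul_le_mul hβ1 hβ2 (norm_nonneg _) (by positivity)
  have n1 := norm_nonneg (L Q₁ t); have n2 := norm_nonneg (L Q₂ t); have n3 := norm_nonneg (L Q₃ t)
  have hb2sq : (alpha D * ‖L Q₂ t‖) ^ 2 ≤ 4 ^ 2 := pow_le_pow_left₀ (by positivity) hb2 2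
  have hb3sq : (alpha D * ‖L Q₃ t‖) ^ 2 ≤ 4 ^ 2 := pow_le_pow_left₀ (by positivity) hb3 2
  have hval : ‖-1 + S * -L Q₁ t + Pr / 2 * (L Q₂ t * L Q₂ t - 2 * (L Q₃ t * L Q₃ t))‖ ≤ 417 := by
    have e1 : ‖S * -L Q₁ t‖ ≤ 8 * (alpha D * ‖L Q₁ t‖) := by
      rw [norm_mul, norm_neg]; nlinarith
    have e2 : ‖Pr / 2 * (L Q₂ t * L Q₂ t - 2 * (L Q₃ t * L Q₃ t))‖ ≤
        8 * ((alpha D * ‖L Q₂ t‖) ^ 2 + 2 * (alpha D * ‖L Q₃ t‖) ^ 2) := by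
      have : ‖L Q₂ t * L Q₂ t - 2 * (L Q₃ t * L Q₃ t)‖ ≤ ‖L Q₂ t‖ ^ 2 + 2 * ‖L Q₃ t‖ ^ 2 := by
        refine (norm_sub_le _ _).trans ?_
        rw [norm_mul, norm_mul, norm_mul, Complex.norm_two]; nlinarith
      rw [norm_mul, norm_div, Complex.norm_two]
      calc ‖Pr‖ / 2 * ‖L Q₂ t * L Q₂ t - 2 * (L Q₃ t * L Q₃ t)‖
          ≤ (4 * alpha D) * (4 * alpha D) / 2 * (‖L Q₂ t‖ ^ 2 + 2 * ‖L Q₃ t‖ ^ 2) := by gcongr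
        _ = 8 * ((alpha D * ‖L Q₂ t‖) ^ 2 + 2 * (alpha D * ‖L Q₃ t‖) ^ 2) := by ring
    calc _ ≤ ‖(-1 : ℂ)‖ + ‖S * -L Q₁ t‖ + ‖Pr / 2 * (L Q₂ t * L Q₂ t - 2 * (L Q₃ t * L Q₃ t))‖ :=
          norm_add₃_le
      _ ≤ 1 + 8 * 4 + 8 * (4 ^ 2 + 2 * 4 ^ 2) := by
          rw [norm_neg, norm_one]
          gcongr
          · exact e1.trans (by linarith)
          · exact e2.trans (by linarith)
      _ = 417 := by norm_num
  have hder : ‖S - Pr * L Q₂ t + 2 * Pr * L Q₃ t‖ ≤ 200 * alpha D := by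
    calc _ ≤ ‖S - Pr * L Q₂ t‖ + ‖2 * Pr * L Q₃ t‖ := norm_add_le _ _
      _ ≤ ‖S‖ + ‖Pr * L Q₂ t‖ + ‖2 * Pr * L Q₃ t‖ := by gcongr; exact norm_sub_le _ _
      _ = ‖S‖ + ‖Pr‖ * ‖L Q₂ t‖ + 2 * ‖Pr‖ * ‖L Q₃ t‖ := by
          rw [norm_mul Pr (L Q₂ t), norm_mul (2 * Pr) (L Q₃ t), norm_mul (2 : ℂ) Pr,
            Complex.norm_two]
      _ ≤ 8 * alpha D + (4 * alpha D) * (4 * alpha D) * ‖L Q₂ t‖ +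
            2 * ((4 * alpha D) * (4 * alpha D)) * ‖L Q₃ t‖ := by gcongr
      _ = 8 * alpha D + 16 * alpha D * (alpha D * ‖L Q₂ t‖) +
            32 * alpha D * (alpha D * ‖L Q₃ t‖) := by ring
      _ ≤ 8 * alpha D + 16 * alpha D * 4 + 32 * alpha D * 4 := by gcongr
      _ = 200 * alpha D := by ring
  refine ⟨by rw [hfun]; exact hd.differentiableAt, ?_, ?_⟩
  · show ‖(fun u : ℝ => -1 + fraky1 c' D j (bigP D ^ (0.004 : ℝ) * u)) t‖ ≤ 417
    rw [hfun]; exact hval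
  · rw [hfun, hd.deriv, norm_mul, norm_inv, Complex.norm_real, Real.norm_eq_abs, abs_of_pos ht,
      ← div_eq_mul_inv]
    exact div_le_div_of_nonneg_right hder ht.le

/-- **The `m`-side profile `t ↦ ῑ₃𝔣_{j6}(P^{0.498}/t)/0.498 + ῑ₄𝔣_{j7}(P^{0.5}/t)/0.5` on `[1, P]`**:
differentiable, `‖·‖ ≤ 209`, `‖d/dt‖ ≤ 677α/t` (`|ι₃| ≤ 1.25`, `|ι₄| ≤ 2.3`). [cite: Zhang2022LandauSiegel, §10 p. 61] -/
theorem fProfile1214_bounds (c' : ℝ) {D : ℕ} (j : ℕ) {t : ℝ} (hα : 0 < alpha D) (hℓ : 0 ≤ ell D)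
    (hc : 5 * |c'| * alpha D * ell D ≤ 1) (ht1 : 1 ≤ t) (htP : t ≤ bigP D)
    (hΛ4 : alpha D * Real.log (bigP D) ≤ 4) :
    DifferentiableAt ℝ (fun u : ℝ => conj iota3 * frakfW c' D j 6 (bigP D ^ (0.498 : ℝ) / u) / 0.498 +
        conj iota4 * frakfW c' D j 7 (bigP D ^ (0.5 : ℝ) / u) / 0.5) t ∧
      ‖conj iota3 * frakfW c' D j 6 (bigP D ^ (0.498 : ℝ) / t) / 0.498 +
          conj iota4 * frakfW c' D j 7 (bigP D ^ (0.5 : ℝ) / t) / 0.5‖ ≤ 209 ∧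
      ‖deriv (fun u : ℝ => conj iota3 * frakfW c' D j 6 (bigP D ^ (0.498 : ℝ) / u) / 0.498 +
          conj iota4 * frakfW c' D j 7 (bigP D ^ (0.5 : ℝ) / u) / 0.5) t‖ ≤ 677 * alpha D / t := by
  have ht : 0 < t := by linarith
  have hP1 : 1 ≤ bigP D := by linarith
  obtain ⟨hQ2a, hQ2b⟩ := rpow_window hP1 (e := 0.5) (by norm_num) (by norm_num)
  obtain ⟨hQ3a, hQ3b⟩ := rpow_window hP1 (e := 0.498) (by norm_num) (by norm_num)
  obtain ⟨h6d, h6n, h6d'⟩ := Section8AbelProfiles.frakfW_div_bounds c' j 6 hα hℓ hc hQ3a hQ3b ht1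
    htP hΛ4
  obtain ⟨h7d, h7n, h7d'⟩ := Section8AbelProfiles.frakfW_div_bounds c' j 7 hα hℓ hc hQ2a hQ2b ht1
    htP hΛ4
  have hd := ((h6d.hasDerivAt.const_mul (conj iota3)).div_const (0.498 : ℂ)).add
    ((h7d.hasDerivAt.const_mul (conj iota4)).div_const (0.5 : ℂ))
  refine ⟨hd.differentiableAt, (norm_iotaComb_le _ _ h6n h7n).trans (by norm_num), ?_⟩
  have hderiv : deriv (fun u : ℝ => conj iota3 * frakfW c' D j 6 (bigP D ^ (0.498 : ℝ) / u) / 0.498 +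
      conj iota4 * frakfW c' D j 7 (bigP D ^ (0.5 : ℝ) / u) / 0.5) t =
      conj iota3 * deriv (fun u => frakfW c' D j 6 (bigP D ^ (0.498 : ℝ) / u)) t / 0.498 +
        conj iota4 * deriv (fun u => frakfW c' D j 7 (bigP D ^ (0.5 : ℝ) / u)) t / 0.5 := hd.deriv
  rw [hderiv]
  calc ‖conj iota3 * deriv (fun u => frakfW c' D j 6 (bigP D ^ (0.498 : ℝ) / u)) t / 0.498 +
        conj iota4 * deriv (fun u => frakfW c' D j 7 (bigP D ^ (0.5 : ℝ) / u)) t / 0.5‖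
      ≤ 7.2 * (94 * alpha D / t) := norm_iotaComb_le _ _ h6d' h7d'
    _ ≤ 677 * alpha D / t := by
        rw [← mul_div_assoc, div_le_div_iff_of_pos_right ht]; nlinarith [hα]

/-- **The middle-range profile `t ↦ (ῑ₃𝔣_{j6}(P^{0.498}/t)/0.498 + ῑ₄𝔣_{j7}(P^{0.5}/t)/0.5)(−1 + 𝔶_{1j}(P^{0.004}t))`
on `[1, P]`**: differentiable, `‖·‖ ≤ 87153`, `‖d/dt‖ ≤ 324109α/t`. [cite: Zhang2022LandauSiegel, §10 p. 61] -/
theorem midProfile_bounds (c' : ℝ) {D : ℕ} (j : ℕ) {t : ℝ} (hα : 0 < alpha D) (hℓ : 0 ≤ ell D)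
    (hc : 5 * |c'| * alpha D * ell D ≤ 1) (ht1 : 1 ≤ t) (htP : t ≤ bigP D)
    (hΛ4 : alpha D * Real.log (bigP D) ≤ 4) :
    DifferentiableAt ℝ (fun u : ℝ => (conj iota3 * frakfW c' D j 6 (bigP D ^ (0.498 : ℝ) / u) / 0.498 +
        conj iota4 * frakfW c' D j 7 (bigP D ^ (0.5 : ℝ) / u) / 0.5) *
        (-1 + fraky1 c' D j (bigP D ^ (0.004 : ℝ) * u))) t ∧
      ‖(conj iota3 * frakfW c' D j 6 (bigP D ^ (0.498 : ℝ) / t) / 0.498 +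
          conj iota4 * frakfW c' D j 7 (bigP D ^ (0.5 : ℝ) / t) / 0.5) *
          (-1 + fraky1 c' D j (bigP D ^ (0.004 : ℝ) * t))‖ ≤ 87153 ∧
      ‖deriv (fun u : ℝ => (conj iota3 * frakfW c' D j 6 (bigP D ^ (0.498 : ℝ) / u) / 0.498 +
          conj iota4 * frakfW c' D j 7 (bigP D ^ (0.5 : ℝ) / u) / 0.5) *
          (-1 + fraky1 c' D j (bigP D ^ (0.004 : ℝ) * u))) t‖ ≤ 324109 * alpha D / t := by
  obtain ⟨hfd, hfn, hfd'⟩ := fProfile1214_bounds c' j hα hℓ hc ht1 htP hΛ4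
  obtain ⟨hgd, hgn, hgd'⟩ := y1Profile_bounds c' j hα hℓ hc ht1 htP hΛ4
  obtain ⟨h1, h2, h3⟩ := Section8AbelProfiles.mul_bounds hfd hgd hfn hgn hfd' hgd' (by norm_num)
  refine ⟨h1, h2.trans (by norm_num), h3.trans (le_of_eq ?_)⟩
  ring

/-- `𝔶𝔶_{1j}` applied. [cite: Zhang2022LandauSiegel, §10 p. 57] -/
theorem yyJ1_apply (j : ℕ) (w : ℝ) :
    yyJ1 j w = if j = 1 then yy11 w else if j = 2 then yy12 w else yy13 w := by
  unfold yyJ1 byJ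
  split_ifs <;> rfl

/-- `‖𝔣𝔣_{j6}(w)‖ ≤ 6` for `|w| ≤ 1` (`a ∈ {1/2, −1/2, −3/2}`). [cite: Zhang2022LandauSiegel, §8 (8.13)–(8.15)] -/
theorem norm_ffJ6_le (j : ℕ) {w : ℝ} (hw : |w| ≤ 1) : ‖ffJ6 j w‖ ≤ 6 := by
  have hπ := Real.pi_lt_d2
  have key : ∀ a k : ℚ, |(a : ℝ)| ≤ 3 / 2 → ‖ffF a k w‖ ≤ 6 := by
    intro a k ha
    refine (norm_ffF_le a k w).trans ?_
    have h1 : |(a : ℝ)| * π ≤ 3 / 2 * 3.15 := mul_le_mul ha hπ.le Real.pi_pos.le (by norm_num)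
    have h2 : |(a : ℝ)| * π * |w| ≤ 3 / 2 * 3.15 * 1 :=
      mul_le_mul h1 hw (abs_nonneg _) (by norm_num)
    linarith
  unfold ffJ6 byJ ff16 ff26 ff36
  split_ifs
  · exact key _ _ (by norm_num)
  · exact key _ _ (by norm_num [abs_of_nonpos])
  · exact key _ _ (by norm_num [abs_of_nonpos])

/-- `𝔣_{j6}(P^{0.498}/P^z) = 𝔣(β_j, β₆; (0.498 − z)·log P)`. [cite: Zhang2022LandauSiegel, §8 Lemma 8.2] -/
theorem frakfW6_at_rpow (c' : ℝ) (D j : ℕ) (z : ℝ) :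
    frakfW c' D j 6 (bigP D ^ (0.498 : ℝ) / bigP D ^ z) =
      frakf (betaJ c' D j) (beta6 D) ((Real.log (bigP D) : ℂ) * (((0.498 - z : ℝ)) : ℂ)) := by
  have hP : 0 < bigP D := Real.exp_pos _
  have h6 : betaMu D 6 = beta6 D := by norm_num [betaMu]
  rw [frakfW, h6, ← Real.rpow_sub hP, Real.log_rpow hP]
  congr 1
  rw [Complex.ofReal_mul, mul_comm]

/-- The substitution `u = 0.498 − z`: `∫_{0.496}^{0.498} H(0.498 − z)dz = ∫₀^{0.002} H`. [cite: Zhang2022LandauSiegel, §10 p. 61] -/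
theorem integral_mid_reflect (H : ℝ → ℂ) :
    ∫ z in (0.496 : ℝ)..0.498, H (0.498 - z) = ∫ u in (0 : ℝ)..0.002, H u := by
  rw [intervalIntegral.integral_comp_sub_left H (0.498 : ℝ)]
  norm_num

/-- **Z22:§10.u056 (ii) HOLDS** [Z22 p.61, tex L3089, second line]: `Mid1214Int c′` — "`… =
(500𝔞/log P)∫₀^{0.002}(ῑ₃𝔣𝔣_{j6}(z)/0.498 + ῑ₄𝔣𝔣_{j7}(0.002 + z)/0.5)(−1 + 𝔶𝔶_{1j}(0.502 − z))dz + o(α)`":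
`‖midSum1214 − midInt1214‖ ≤ εα` for all large `D` (under (A), `j ∈ {1,2,3}`). Proof: `lamAvg_second_line`
(`κ = 500`, window `[P^{0.496}, P^{0.498}]`), `midProfile_bounds`, main values via `norm_frakf_sub_ffJ`
(sz-d34) and `Typed.Sec10A.step10u024_holds` (Z22:§10.u024, typed under (A)), `u = 0.498 − z`;
error `O_{c′}(𝓛⁻¹²) = o(α)`. [cite: Zhang2022LandauSiegel, §10 p. 61, tex L3089] -/
theorem mid1214Int_holds (c' : ℝ) : Mid1214Int c' := by
  intro ε hε
  obtain ⟨C₂₄, h24⟩ := Sec10A.step10u024_holds c'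
  set C₀ : ℝ := 417 * (36 * π ^ 2 * |c'|) + 44 * |C₂₄| with hC₀
  have hC₀0 : 0 ≤ C₀ := by positivity
  have hgen := lamAvg_second_line c' (500 : ℂ) (a := 0.496) (b := 0.498) (M := 87153)
    (M' := 324109) (C₀ := C₀) (by norm_num) (by norm_num) (by norm_num) (by norm_num) (by norm_num)
    hC₀0 ε hε
  have h5 := forAllLarge_ell_six (5 * c')
  refine ((hgen.and h24).and h5).mono ?_
  intro D _ χ hq hp ⟨⟨hG, h24D⟩, hℓ6, hc5⟩ hA j hj
  -- parameters
  have hℓ0 : 0 < ell D := by linarith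
  have hP : 0 < bigP D := Real.exp_pos _
  have hP1 : 1 < bigP D := by rw [bigP]; exact Real.one_lt_exp_iff.2 (pow_pos hℓ0 9)
  have hlogP : Real.log (bigP D) = ell D ^ 9 := by rw [bigP, Real.log_exp]
  have hΛ : 0 < Real.log (bigP D) := by rw [hlogP]; positivity
  have hα : 0 < alpha D := alpha_pos hΛ
  have hαℓ : alpha D * ell D = π / ell D ^ 8 := alpha_mul_ell hℓ0
  have hΛ4 : alpha D * Real.log (bigP D) ≤ 4 := by
    rw [alpha, div_mul_cancel₀ _ hΛ.ne']; linarith [Real.pi_lt_d2]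
  have hc : 5 * |c'| * alpha D * ell D ≤ 1 := by
    have : |5 * c'| = 5 * |c'| := by rw [abs_mul, abs_of_pos (by norm_num : (0:ℝ) < 5)]
    rw [this] at hc5; linarith [hc5]
  have hlo1 : 1 ≤ bigP D ^ (0.496 : ℝ) := Real.one_le_rpow hP1.le (by norm_num)
  have hhiP : bigP D ^ (0.498 : ℝ) + 1 ≤ bigP D :=
    rpow_add_one_le_bigP (by norm_num) (by norm_num) (by linarith) (by nlinarith)
  -- the profile and its main value
  set F : ℝ → ℂ := fun t => (conj iota3 * frakfW c' D j 6 (bigP D ^ (0.498 : ℝ) / t) / 0.498 +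
      conj iota4 * frakfW c' D j 7 (bigP D ^ (0.5 : ℝ) / t) / 0.5) *
    (-1 + fraky1 c' D j (bigP D ^ (0.004 : ℝ) * t)) with hF
  set H : ℝ → ℂ := fun u => (conj iota3 * ffJ6 j u / 0.498 + conj iota4 * ffJ7 j (0.002 + u) / 0.5) *
    (-1 + yyJ1 j (0.502 - u)) with hH
  set G₀ : ℝ → ℂ := fun z => H (0.498 - z) with hG₀
  have hprof : ∀ t : ℝ, bigP D ^ (0.496 : ℝ) ≤ t → t ≤ bigP D ^ (0.498 : ℝ) + 1 →
      DifferentiableAt ℝ F t ∧ ‖F t‖ ≤ 87153 ∧ ‖deriv F t‖ ≤ 324109 * alpha D / t := by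
    intro t h1 h2
    exact midProfile_bounds c' j hα hℓ0.le hc (hlo1.trans h1) (h2.trans hhiP) hΛ4
  have hG₀i : IntervalIntegrable G₀ volume (0.496 : ℝ) 0.498 := by
    apply Continuous.intervalIntegrable
    rw [hG₀, hH]
    fun_prop
  have happrox : ∀ z ∈ Set.Icc (0.496 : ℝ) 0.498, ‖F (bigP D ^ z) - G₀ z‖ ≤ C₀ / ell D ^ 8 := by
    intro z hz
    obtain ⟨hz1, hz2⟩ := hz
    set f₆ : ℂ := frakfW c' D j 6 (bigP D ^ (0.498 : ℝ) / bigP D ^ z) with hf₆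
    set f₇ : ℂ := frakfW c' D j 7 (bigP D ^ (0.5 : ℝ) / bigP D ^ z) with hf₇
    set y : ℂ := -1 + fraky1 c' D j (bigP D ^ (0.004 : ℝ) * bigP D ^ z) with hy
    set f₆₀ : ℂ := ffJ6 j (0.498 - z) with hf₆₀
    set f₇₀ : ℂ := ffJ7 j (0.002 + (0.498 - z)) with hf₇₀
    set y₀ : ℂ := -1 + yyJ1 j (0.502 - (0.498 - z)) with hy₀
    have eF : F (bigP D ^ z) - G₀ z =
        (conj iota3 * (f₆ - f₆₀) / 0.498 + conj iota4 * (f₇ - f₇₀) / 0.5) * y +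
          (conj iota3 * f₆₀ / 0.498 + conj iota4 * f₇₀ / 0.5) * (y - y₀) := by
      simp only [hF, hG₀, hH, hf₆, hf₇, hy, hf₆₀, hf₇₀, hy₀]; ring
    have hu : |c' * alpha D * ell D| = |c'| * (π / ell D ^ 8) := by
      rw [mul_assoc, abs_mul, hαℓ, abs_of_pos (show (0:ℝ) < π / ell D ^ 8 by positivity)]
    have hw6 : |(0.498 : ℝ) - z| ≤ 1 := by rw [abs_le]; constructor <;> linarith
    have hw7 : |(0.5 : ℝ) - z| ≤ 1 := by rw [abs_le]; constructor <;> linarith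
    have h6 : ‖f₆ - f₆₀‖ ≤ 5 * π ^ 2 * |c'| / ell D ^ 8 := by
      rw [hf₆, hf₆₀, frakfW6_at_rpow]
      refine (norm_frakf_sub_ffJ (c' := c') hΛ hj (0.498 - z)).1.trans ?_
      rw [hu]
      calc 5 * π * (|c'| * (π / ell D ^ 8)) * |(0.498 : ℝ) - z|
          ≤ 5 * π * (|c'| * (π / ell D ^ 8)) * 1 := by gcongr
        _ = 5 * π ^ 2 * |c'| / ell D ^ 8 := by ring
    have h7 : ‖f₇ - f₇₀‖ ≤ 5 * π ^ 2 * |c'| / ell D ^ 8 := by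
      rw [hf₇, hf₇₀, frakfW7_at_rpow, show (0.002 : ℝ) + (0.498 - z) = 0.5 - z by ring]
      refine (norm_frakf_sub_ffJ (c' := c') hΛ hj (0.5 - z)).2.trans ?_
      rw [hu]
      calc 5 * π * (|c'| * (π / ell D ^ 8)) * |(0.5 : ℝ) - z|
          ≤ 5 * π * (|c'| * (π / ell D ^ 8)) * 1 := by gcongr
        _ = 5 * π ^ 2 * |c'| / ell D ^ 8 := by ring
    have hAd : ‖conj iota3 * (f₆ - f₆₀) / 0.498 + conj iota4 * (f₇ - f₇₀) / 0.5‖ ≤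
        7.2 * (5 * π ^ 2 * |c'| / ell D ^ 8) := norm_iotaComb_le _ _ h6 h7
    have hA₀ : ‖conj iota3 * f₆₀ / 0.498 + conj iota4 * f₇₀ / 0.5‖ ≤ 7.2 * 6 :=
      norm_iotaComb_le _ _ (norm_ffJ6_le j hw6)
        (norm_ffJ7_le j (by rw [show (0.002 : ℝ) + (0.498 - z) = 0.5 - z by ring]; exact hw7))
    -- `‖y‖ ≤ 417`
    have hyn : ‖y‖ ≤ 417 := by
      have hPz1 : 1 ≤ bigP D ^ z := Real.one_le_rpow hP1.le (by linarith)
      have hPzP : bigP D ^ z ≤ bigP D := by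
        calc bigP D ^ z ≤ bigP D ^ (1 : ℝ) := Real.rpow_le_rpow_of_exponent_le hP1.le (by linarith)
          _ = bigP D := Real.rpow_one _
      exact (y1Profile_bounds c' j hα hℓ0.le hc hPz1 hPzP hΛ4).2.1
    -- `‖y − y₀‖ ≤ |C₂₄|𝓛⁻⁸` (Z22:§10.u024 at `w = z + 0.004`)
    have hyy : ‖y - y₀‖ ≤ |C₂₄| / ell D ^ 8 := by
      have hw0 : (0 : ℝ) ≤ 0.502 - (0.498 - z) := by linarith
      have hw1 : 0.502 - (0.498 - z) ≤ (1 : ℝ) := by linarith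
      have h := (h24D hA j hj (0.502 - (0.498 - z)) hw0 hw1).1
      have ew : bigP D ^ (0.004 : ℝ) * bigP D ^ z = bigP D ^ ((0.502 : ℝ) - (0.498 - z)) := by
        rw [← Real.rpow_add hP]; congr 1; ring
      have ey : y - y₀ = fraky1 c' D j (bigP D ^ ((0.502 : ℝ) - (0.498 - z))) -
          (if j = 1 then yy11 (0.502 - (0.498 - z)) else if j = 2 then yy12 (0.502 - (0.498 - z))
            else yy13 (0.502 - (0.498 - z))) := by
        rw [hy, hy₀, ew, yyJ1_apply]; ring
      rw [ey]
      refine h.trans ?_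
      rw [← div_eq_mul_inv]
      gcongr
      exact le_abs_self _
    rw [eF]
    calc _ ≤ ‖conj iota3 * (f₆ - f₆₀) / 0.498 + conj iota4 * (f₇ - f₇₀) / 0.5‖ * ‖y‖ +
          ‖conj iota3 * f₆₀ / 0.498 + conj iota4 * f₇₀ / 0.5‖ * ‖y - y₀‖ := by
          refine (norm_add_le _ _).trans ?_; rw [norm_mul, norm_mul]
      _ ≤ 7.2 * (5 * π ^ 2 * |c'| / ell D ^ 8) * 417 + 7.2 * 6 * (|C₂₄| / ell D ^ 8) :=
          add_le_add (mul_le_mul hAd hyn (norm_nonneg _) (by positivity))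
            (mul_le_mul hA₀ hyy (norm_nonneg _) (by norm_num))
      _ = (15012 * (π ^ 2 * |c'|) + 43.2 * |C₂₄|) / ell D ^ 8 := by ring
      _ ≤ C₀ / ell D ^ 8 := by
          rw [hC₀]
          exact div_le_div_of_nonneg_right (by linarith [abs_nonneg C₂₄]) (by positivity)
  -- the engine
  have key := hG j F G₀ hprof hG₀i happrox
  have hsub : ∫ z in (0.496 : ℝ)..0.498, G₀ z = ∫ u in (0 : ℝ)..0.002, H u := by
    rw [hG₀]; exact integral_mid_reflect H
  rw [hsub] at key
  have eS : midSum1214 c' χ j = (500 : ℂ) * deriv χ.LFunction 1 ^ 2 /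
      (Real.log (bigP D) : ℂ) ^ 2 * lamAvg c' χ j (bigP D ^ (0.496 : ℝ)) (bigP D ^ (0.498 : ℝ))
        (fun n => F n) := by
    simp only [midSum1214, hF]
  have eI : midInt1214 χ j = (500 : ℂ) * (frakA χ : ℂ) / (Real.log (bigP D) : ℂ) *
      ∫ u in (0 : ℝ)..0.002, H u := by
    simp only [midInt1214, hH]
  rw [eS, eI]
  exact key

variable (c' : ℝ) in
/-- `Mid1214Int` — `_holds` alias of `mid1214Int_holds` above under the fact's exact name, stated under the
prover's own binders as section variables (appended 2026-08-28, D-0026 bookkeeping: the proof term is the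
existing theorem of this file; no statement, definition or attribute is edited; no new named fact; the
ledger's debt table listed the fact unproved). [cite: Zhang2022LandauSiegel, §10 p. 61, tex L3089] -/
theorem _root_.Literature.NumberTheory.LFunctions.Zhang2022.Typed.Sec10C.Mid1214Int_holds :
    _root_.Literature.NumberTheory.LFunctions.Zhang2022.Typed.Sec10C.Mid1214Int c' :=
  _root_.Literature.NumberTheory.LFunctions.Zhang2022.Typed.Sec10C.mid1214Int_holds (c' := c')

end D39Mid1214Int

end Literature.NumberTheory.LFunctions.Zhang2022.Typed.Sec10C
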